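import Summits.CriticalPhenomena.PercolationContinuityZ3.Theorems.PercNearOneGluingNoHeavyLowerTailKnQuestion8CoefficientwiseOffCluster
import Summits.CriticalPhenomena.PercolationContinuityZ3.Theorems.PercNearOneGluingNoHeavyLowerTailKnQuestion8AntitheticProduct
import HarnessLib

/-!
# `Q_mix(p,q) ≥ 0` when `f` needs both `p` and `q` ('Harris twice', second class) — prim-lf-2 gen 48

Support file (`--supports stmt-CriticalPhenomena-4575`, closed), prover `prim-lf-2` (gen 48).  No definitions, no named facts, no sorries;
standard axioms.  Memo `prim-lf-2/CW-HT-gen48.md` §2; companion file `…KnQuestion8CoefficientwiseHarrisTwice.lean` (the class `f ∈ {1_p, 1_q}`).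

Setting as there: finite multigraph `ends : ι → Sym2 V`, root `x`, colouring `s : Finset ι` (red) / `sᶜ` (blue), `K(s) = C_x(s) = openCluster (ends '' s) x`,
`f̂(s) = f(K s) − f(K sᶜ)`, `Q_mix(p,q) := Σ_{s : ¬(p ∈ K s ∧ q ∈ K sᶜ)} f̂ ĝ` (CONJECTURE Q_mix ≥ 0 for all monotone `f, g`; memo CW-QMIX-gen47).

'Harris twice' (the antithetic kernel `AntitheticProduct.sum_mul_sub_compl_nonneg`: `Σ_s a(s)(B(s) − B(sᶜ)) ≥ 0` for monotone `a, B`) signs `Σ_{s∈A} f̂ĝ`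
exactly when the folded coefficient `(1_A(s) + 1_A(sᶜ))·f̂(s)` is monotone on the colouring cube (memo §2).  For the `Q_mix` event this holds for
`f ∈ {1_p, 1_q}` (companion file) and — this file — for every monotone `f` that NEEDS BOTH `p` AND `q`, i.e. `f(C) = f(∅)` unless `{p,q} ⊆ C`
(examples: `1[S ⊆ C]` for any `S ⊇ {p,q}`, `1[{p,q} ⊆ C]·h(C)` with `h ≥ 0` monotone):
* `qmix_needsBoth_eq` — `Q_mix(p,q) = Σ_s ([p ∉ K sᶜ] + [q ∉ K sᶜ])·(f(K s) − f ∅)·ĝ(s)`  (on a colouring with `f(K s) > f ∅` both `p, q` are red-reached, so the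
  exclusion keeps `[q ∉ K̄]`; the colour swap folds the blue-side part onto `[p ∉ K̄]`);
* `qmix_nonneg_of_needsBoth` — hence `0 ≤ Q_mix(p,q)` for all monotone `g` (the weight `([p ∉ K̄] + [q ∉ K̄])(f(K) − f ∅)` is monotone and `≥ 0`).
Exact census of the criterion (`prim-lf-2/code/gen48/c/htcrit.c`, all graphs on ≤ 5 vertices, all `(p,q,r)`): monotone for `1_p, 1_q, AND(p,q), OR(p,q), AND(p,q,r)`,
`AND(p,q)·(1+1_r)`, `AND(p,q)·|C|` (0 failures / 26 208 each); NOT monotone for `1_r, AND(p,r), OR(p,r), 1_p + 1_r` (9 672 / 3 192 / 2 256 / 3 192 failures) although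
`Q_mix ≥ 0` there too (0 negatives) — beyond these two classes the conjecture needs more than the global kernel.
[cite: KozmaNitzan2024, Questions 8–9 (§5.5 p. 36) (context: the Question-8 pocket covariance programme)]
-/

namespace Summit.CriticalPhenomena.PercolationContinuityZ3.Theorems

open Finset Literature.Probability.Percolation

namespace Coefficientwise

variable {ι V : Type*} [Fintype ι] [DecidableEq ι] (ends : ι → Sym2 V) (x : V)

open Classical in
/-- **The folded form of `Q_mix(p,q)` when `f` needs both `p` and `q`.**  If `f(C) = f(∅)` whenever `¬({p,q} ⊆ C)`, then for every `g`
`Σ_{s : ¬(p ∈ K s ∧ q ∈ K sᶜ)} (f(K s) − f(K sᶜ))·ĝ(s) = Σ_s ([p ∉ K sᶜ] + [q ∉ K sᶜ])·(f(K s) − f ∅)·ĝ(s)`, `ĝ(s) = g(K s) − g(K sᶜ)`.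
[cite: KozmaNitzan2024, Questions 8–9 (§5.5 p. 36) (context)] -/
theorem qmix_needsBoth_eq (p q : V) (f g : Set V → ℝ) (hf0 : ∀ C : Set V, ¬ (p ∈ C ∧ q ∈ C) → f C = f ∅) :
    ∑ s ∈ univ.filter (fun s : Finset ι => ¬ (p ∈ openCluster (ends '' (↑s : Set ι)) x ∧ q ∈ openCluster (ends '' (↑(sᶜ) : Set ι)) x)),
      (f (openCluster (ends '' (↑s : Set ι)) x) - f (openCluster (ends '' (↑(sᶜ) : Set ι)) x)) *
        (g (openCluster (ends '' (↑s : Set ι)) x) - g (openCluster (ends '' (↑(sᶜ) : Set ι)) x)) =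
    ∑ s : Finset ι, (((if p ∉ openCluster (ends '' (↑(sᶜ) : Set ι)) x then (1 : ℝ) else 0) + (if q ∉ openCluster (ends '' (↑(sᶜ) : Set ι)) x then (1 : ℝ) else 0)) *
        (f (openCluster (ends '' (↑s : Set ι)) x) - f ∅)) *
      (g (openCluster (ends '' (↑s : Set ι)) x) - g (openCluster (ends '' (↑(sᶜ) : Set ι)) x)) := by
  set K : Finset ι → Set V := fun s => openCluster (ends '' (↑s : Set ι)) x with hK
  set gh : Finset ι → ℝ := fun s => g (K s) - g (K sᶜ) with hgh
  set F : Finset ι → ℝ := fun s => f (K s) - f ∅ with hF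
  have hF0 : ∀ s : Finset ι, ¬ (p ∈ K s ∧ q ∈ K s) → F s = 0 := fun s hs => by
    simp only [hF, hf0 (K s) hs, sub_self]
  change ∑ s ∈ univ.filter (fun s : Finset ι => ¬ (p ∈ K s ∧ q ∈ K sᶜ)), (f (K s) - f (K sᶜ)) * gh s =
    ∑ s : Finset ι, (((if p ∉ K sᶜ then (1 : ℝ) else 0) + (if q ∉ K sᶜ then (1 : ℝ) else 0)) * F s) * gh s
  rw [Finset.sum_filter]
  -- pointwise: the filtered summand is `[q ∉ K sᶜ]·F(s)·ĝ − [p ∉ K s]·F(sᶜ)·ĝ`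
  have hpt : ∀ s : Finset ι, (if ¬ (p ∈ K s ∧ q ∈ K sᶜ) then (f (K s) - f (K sᶜ)) * gh s else 0) =
      (if q ∉ K sᶜ then (1 : ℝ) else 0) * F s * gh s - (if p ∉ K s then (1 : ℝ) else 0) * F sᶜ * gh s := by
    intro s
    have hfd : f (K s) - f (K sᶜ) = F s - F sᶜ := by simp only [hF]; ring
    rw [hfd]
    by_cases hs : p ∈ K s ∧ q ∈ K s
    · by_cases hc : p ∈ K sᶜ ∧ q ∈ K sᶜ
      · have h1 := hs.1; have h2 := hc.2
        simp [h1, h2]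
      · have hFc : F sᶜ = 0 := hF0 sᶜ (by simpa only [compl_compl] using hc)
        have h1 := hs.1
        rw [hFc]
        by_cases h4 : q ∈ K sᶜ <;> simp [h1, h4]
    · have hFs : F s = 0 := hF0 s hs
      rw [hFs]
      by_cases hc : p ∈ K sᶜ ∧ q ∈ K sᶜ
      · have h2 := hc.2
        by_cases h1 : p ∈ K s <;> simp [h1, h2]
      · have hFc : F sᶜ = 0 := hF0 sᶜ (by simpa only [compl_compl] using hc)
        rw [hFc]; simp
  rw [Finset.sum_congr rfl (fun s _ => hpt s), Finset.sum_sub_distrib]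
  -- the colour swap maps the second part onto minus `Σ [p ∉ K sᶜ]·F(s)·ĝ(s)`
  have hswap : ∑ s : Finset ι, (if p ∉ K s then (1 : ℝ) else 0) * F sᶜ * gh s =
      - ∑ s : Finset ι, (if p ∉ K sᶜ then (1 : ℝ) else 0) * F s * gh s := by
    rw [← Fintype.sum_equiv (Equiv.mk (fun s : Finset ι => sᶜ) (fun s => sᶜ) (fun s => compl_compl s) (fun s => compl_compl s))
      (fun s : Finset ι => (if p ∉ K sᶜ then (1 : ℝ) else 0) * F sᶜᶜ * gh sᶜ) (fun s : Finset ι => (if p ∉ K s then (1 : ℝ) else 0) * F sᶜ * gh s)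
      (fun s => by simp only [Equiv.coe_fn_mk, compl_compl]), ← Finset.sum_neg_distrib]
    refine Finset.sum_congr rfl fun s _ => ?_
    have hgg : gh sᶜ = - gh s := by simp only [hgh, compl_compl]; ring
    rw [compl_compl, hgg]; ring
  rw [hswap, sub_neg_eq_add, ← Finset.sum_add_distrib]
  refine Finset.sum_congr rfl fun s _ => ?_
  ring

open Classical in
/-- **THEOREM (Harris twice, second class): `Q_mix(p,q) ≥ 0` when `f` needs both `p` and `q`.**  For every finite multigraph, root `x`, vertices `p, q`,
monotone `f, g : Set V → ℝ` with `f(C) = f(∅)` unless `{p,q} ⊆ C`: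
`0 ≤ Σ_{s : ¬(p ∈ K s ∧ q ∈ K sᶜ)} (f(K s) − f(K sᶜ))·(g(K s) − g(K sᶜ))`.  Proof: `qmix_needsBoth_eq` + `AntitheticProduct.sum_mul_sub_compl_nonneg` with the monotone
weight `([p ∉ K̄] + [q ∉ K̄])·(f(K) − f ∅)`.  (Covers `f = 1[S ⊆ ·]` for every `S ⊇ {p,q}`; with the companion file, every monotone `f` that is a function of
`([p ∈ ·], [q ∈ ·])` alone.)  [cite: KozmaNitzan2024, Questions 8–9 (§5.5 p. 36) (context)] -/
theorem qmix_nonneg_of_needsBoth (p q : V) (f g : Set V → ℝ) (hf : Monotone f) (hg : Monotone g)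
    (hf0 : ∀ C : Set V, ¬ (p ∈ C ∧ q ∈ C) → f C = f ∅) :
    0 ≤ ∑ s ∈ univ.filter (fun s : Finset ι => ¬ (p ∈ openCluster (ends '' (↑s : Set ι)) x ∧ q ∈ openCluster (ends '' (↑(sᶜ) : Set ι)) x)),
      (f (openCluster (ends '' (↑s : Set ι)) x) - f (openCluster (ends '' (↑(sᶜ) : Set ι)) x)) *
        (g (openCluster (ends '' (↑s : Set ι)) x) - g (openCluster (ends '' (↑(sᶜ) : Set ι)) x)) := by
  rw [qmix_needsBoth_eq ends x p q f g hf0]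
  set K : Finset ι → Set V := fun s => openCluster (ends '' (↑s : Set ι)) x with hK
  have hKmono : ∀ {s t : Finset ι}, s ⊆ t → K s ⊆ K t := fun hst => openCluster_image_mono ends hst x
  refine AntitheticProduct.sum_mul_sub_compl_nonneg
    (fun s : Finset ι => ((if p ∉ K sᶜ then (1 : ℝ) else 0) + (if q ∉ K sᶜ then (1 : ℝ) else 0)) * (f (K s) - f ∅))
    (fun s : Finset ι => g (K s)) ?_ (fun s t hst => hg (hKmono hst))
  intro s t hst
  have hc : K tᶜ ⊆ K sᶜ := hKmono (compl_subset_compl.mpr hst)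
  have h1 : (if p ∉ K sᶜ then (1 : ℝ) else 0) ≤ (if p ∉ K tᶜ then (1 : ℝ) else 0) := by
    by_cases hs : p ∉ K sᶜ
    · have ht : p ∉ K tᶜ := fun h => hs (hc h)
      simp [hs, ht]
    · simp only [hs, if_false]; split_ifs <;> norm_num
  have h2 : (if q ∉ K sᶜ then (1 : ℝ) else 0) ≤ (if q ∉ K tᶜ then (1 : ℝ) else 0) := by
    by_cases hs : q ∉ K sᶜ
    · have ht : q ∉ K tᶜ := fun h => hs (hc h)
      simp [hs, ht]
    · simp only [hs, if_false]; split_ifs <;> norm_num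
  have h3 : f (K s) - f ∅ ≤ f (K t) - f ∅ := by linarith [hf (hKmono hst)]
  have h0 : 0 ≤ f (K s) - f ∅ := by linarith [hf (Set.empty_subset (K s))]
  have h0' : 0 ≤ (if p ∉ K tᶜ then (1 : ℝ) else 0) + (if q ∉ K tᶜ then (1 : ℝ) else 0) := by
    have a : 0 ≤ (if p ∉ K tᶜ then (1 : ℝ) else 0) := by split_ifs <;> norm_num
    have b : 0 ≤ (if q ∉ K tᶜ then (1 : ℝ) else 0) := by split_ifs <;> norm_num
    linarith
  exact mul_le_mul (add_le_add h1 h2) h3 h0 h0'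

end Coefficientwise

end Summit.CriticalPhenomena.PercolationContinuityZ3.Theorems
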